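import Literature.NumberTheory.LFunctions.AlternativeHypothesisTheorem4Proofs
import HarnessLib

/-!
# BGSTB 2025, Theorem 4 AS TYPED = the negation of AH-Density (kernel record of erratum E-ah-4)

Topic `Literature/NumberTheory/LFunctions` (namespace `Literature.NumberTheory.LFunctions`). PROOF
LAYER, one theorem, cell `rh-crit/ah` (C5). LABEL: **NOT RH-BEARING** — a remark that one typed claim
of an unrefereed preprint (arXiv:2508.10857, Theorem 4, as typed in `AlternativeHypothesisFormFactor.lean`)
coincides with the negation of the unproved hypothesis AH-Density; nothing is asserted about AH-Density,
AH-Pairs or RH, and nothing here bears on the truth of RH.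

Cell erratum E-ah-4 (seat t5 g3, `AlternativeHypothesisTheorem4Proofs`, p440772): the typed binder list
of `bgstb2025_theorem4` omits the continuity of `r` that the printed proof (§8: "Since `r(α)` is
continuous and supported in `|α| ≤ 1`, we have `r(k) = 0` for `k ≠ 0`") uses; `r = 1_{{0}}` keeps every
typed hypothesis and falsifies the identity, so the typed claim implies `¬ AHDensity δ`
(`not_ahDensity_of_bgstb2025_theorem4`). Conversely the typed claim has `AHDensity δ →` in front, so
it holds vacuously when AH-Density fails at every bin width. Hence the typed fact is EXACTLY
`∀ δ ∈ (0, 1/2], ¬ AHDensity δ` — an open statement about the zeros, not a literature debt. The printed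
theorem in the authors' reading is the tree theorem `bgstb2025_theorem4_of_continuous` (p440772).

## References

* [BaluyotGoldstonSuriajayaTurnageButterbaugh2025] arXiv:2508.10857, Theorem 4 and §8 (proof of
  Theorem 4), held text `paper:arxiv-2508.10857` p0005, p0018.
-/

noncomputable section

namespace Literature.NumberTheory.LFunctions

/-- **BGSTB 2025, Theorem 4 AS TYPED ⟺ AH-Density fails at every bin width** (kernel record of
E-ah-4): `bgstb2025_theorem4 ↔ ∀ δ, 0 < δ → δ ≤ 1/2 → ¬ AHDensity δ`. (⇒) is the E-ah-4 certificate
`not_ahDensity_of_bgstb2025_theorem4` (the typed binders omit the continuity of `r` used in §8, so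
`r = 1_{{0}}` falsifies the identity under AH-Density); (⇐) is vacuity. The corrected (printed-as-meant)
theorem is `bgstb2025_theorem4_of_continuous`. OURS (a remark on the typing, not a claim of the source).
[cite: BaluyotGoldstonSuriajayaTurnageButterbaugh2025, Theorem 4] -/
theorem bgstb2025_theorem4_iff_not_ahDensity :
    bgstb2025_theorem4 ↔ ∀ δ : ℝ, 0 < δ → δ ≤ 1 / 2 → ¬ AHDensity δ :=
  ⟨fun h _ hδ hδ' ↦ not_ahDensity_of_bgstb2025_theorem4 h hδ hδ',
   fun h δ hδ hδ' hAHD ↦ absurd hAHD (h δ hδ hδ')⟩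

end Literature.NumberTheory.LFunctions

end
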